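import Mathlib
import HarnessLib
import HarnessLib.Audit
import Summits.ResolutionOfSingularities.Statement
import Literature.AlgebraicGeometry.Resolution.RankOneReduction
import Literature.AlgebraicGeometry.Resolution.RankOneReductionProofs
import Summits.ResolutionOfSingularities.ResolutionOfSingularities.Theorems.ValuativeAssembly
import HarnessLib.Audit.Status.Attr

/-!
Route: Valuative

It suffices to show, for every prime p: (LUrel_p) RELATIVE Zariski LOCAL UNIFORMIZATION in
characteristic p — for every finitely generated field extension K/k with char k = p, every valuation
ring O of K containing k and every finitely generated k-subalgebra R ⊆ O there is a finitely
generated k-subalgebra A with R ⊆ A ⊆ O and Frac A = K whose localisation at the centre m_O ∩ A is a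
regular local ring (R ≤ A ⊆ O is one local blowing-up along an ideal, NovacoskiSpivakovsky2014 Def.
2.11/2.20; Temkin's 'affine model X′ refining X') — AND (PatchingRel_p) LUrel_p → ResolutionInChar
p. X is the target ValuativeThesisRel (relative pivot of the survey thesis; the absolute form LU_p ∧
(LU_p → ResolutionInChar p) is the special case R = k — its items ValuativeThesis, Lupi, Patching,
LupiToLu, RankOneReduction and the PROVED frame Assembly (Assembly_holds) remain in the file as
SUPERSEDED special cases: nobody should be seated on them). The deciding theorem goes through the
cruxes, not through X: for every prime p, LuAlphaPTorsor (local uniformization of α_p-torsors t^p =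
a over bases regular at the centre, rank 2) → TorsorToLurel (Temkin's inseparable reduction for
every ground field k, crux rank 4 since 2026-08-16 — crux-only deciding theorem) → LUrel_p →
PatchingRel (Zariski patching, rank 3) → ResolutionInChar p; the summit is ∀ p prime,
ResolutionInChar p by definition (closes : LuAlphaPTorsor → TorsorToLurel → PatchingRel →
ResolutionOfSingularities, pure logic).
Lean (elaborates, no `open`; pure commutative algebra over Mathlib's ValuationSubring / Subalgebra /
Localization.AtPrime / IsRegularLocalRing):
∀ p : ℕ, p.Prime → (∀ (k K : Type) [Field k] [CharP k p] [Field K] [Algebra k K], (⊤ :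
IntermediateField k K).FG → ∀ O : ValuationSubring K, (∀ c : k, algebraMap k K c ∈ O) → ∀ R :
Subalgebra k K, R.FG → R.toSubring ≤ O.toSubring → ∃ (A : Subalgebra k K) (h : A.toSubring ≤
O.toSubring), R ≤ A ∧ A.FG ∧ IsFractionRing A K ∧ IsRegularLocalRing (Localization.AtPrime
(Ideal.comap (Subring.inclusion h) (IsLocalRing.maximalIdeal O)))) ∧ ((∀ (k K : Type) [Field k]
[CharP k p] [Field K] [Algebra k K], (⊤ : IntermediateField k K).FG → ∀ O : ValuationSubring K, (∀ c
: k, algebraMap k K c ∈ O) → ∀ R : Subalgebra k K, R.FG → R.toSubring ≤ O.toSubring → ∃ (A :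
Subalgebra k K) (h : A.toSubring ≤ O.toSubring), R ≤ A ∧ A.FG ∧ IsFractionRing A K ∧
IsRegularLocalRing (Localization.AtPrime (Ideal.comap (Subring.inclusion h)
(IsLocalRing.maximalIdeal O)))) → Literature.AlgebraicGeometry.Resolution.ResolutionInChar.{0} p)

Rationale: WHY THIS LINE. (widen: valuation theory + model theory of valued fields.) Zariski's programme —
local uniformization (LU) along every valuation of the function field, then patch finitely many
local uniformizations using quasi-compactness of the Riemann–Zariski space — is the ONLY strategy
that has produced characteristic-p theorems in dimension 3 (CossartPiltant2008
doi:10.1016/j.jalgebra.2008.03.032, CossartPiltant2009, CossartPiltant2019). Its local half lives in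
valuation theory, where a separate community has sharp, dimension-free tools: LU for Abhyankar
places in any characteristic (KnafKuhlmann2005 Thm 1.1), LU after a finite purely inseparable
extension of the function field (Temkin2013 = arXiv:0804.1554 Thm 1.2, vendored as
Literature.AlgebraicGeometry.Resolution.Temkin2013Relative and reduced in tree to the single leaf
Temkin2013RelativeCurveSmoothFibre), reduction of LU to RANK-ONE valuations
(NovacoskiSpivakovsky2014 = arXiv:1204.4751 Thm 1.1, PROVED in tree:
NovacoskiSpivakovsky2014_holds), and Kuhlmann's defect theory (the obstruction is exactly the DEFECT
of immediate purely inseparable / Artin–Schreier extensions of rank-one valued function fields; tame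
fields, AKE principles). Temkin2013 Rem 1.5(ii)-(iii): LU_p follows from LU of μ_p/α_p-torsors t^p =
a over REGULAR schemes. So the local half has ONE crisp, purely algebraic crux (LuAlphaPTorsor)
typed over Mathlib (ValuationSubring, Subalgebra.FG, IsRegularLocalRing) with no scheme theory;
everything is stated in the RELATIVE form (dominate a given finitely generated R ⊆ O), which is what
both Temkin's tower and Zariski patching consume.
RANKED CRUXES. #2 LuAlphaPTorsor — for k of char p, O a valuation ring of K, A₀ ⊆ O f.g. and regular
at the centre, t ∈ K with t^p ∈ A₀ and Frac A₀[t] = K: some f.g. A ⊇ A₀[t], A ⊆ O, Frac A = K, is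
regular at the centre (why it might fail: the live case is LU of the Zariski hypersurface t^p = a
over a regular local ring of dimension n, OPEN for n ≥ 4 in every p — Temkin Rem 1.5(iii) 'all bad
things happen', CutkoskyMourtada2019 = arXiv:1711.02726 'we do not know ELU in dimension 4',
HauserPerlega2019 divergent residual order in A^5; known n ≤ 3 by CossartPiltant2008/2009). #3
PatchingRel — LUrel_p → ResolutionInChar p (why it might fail: gluing finitely many local
uniformizations into ONE proper regular model is known only in dimension ≤ 3 — Zariski 1944,
CossartPiltant2008 Prop 4.9, Piltant2013 doi:10.1007/s13398-012-0090-6 — and is open as an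
implication in dimension ≥ 4 even in characteristic 0, CutkoskyMourtada2019 p.3; plain LUrel may be
weaker than the embedded LU the dimension-3 patching consumes). #4 TorsorToLurel — LuAlphaPTorsor ⇒
LUrel_p for EVERY ground field k (Temkin2013 Thm 1.2 with l-SMOOTH centres + Rem 1.5(i)-(ii) run
over k·L^{p^n}); re-kinded support→CRUX on 2026-08-16 under the crux-only deciding-theorem rule
(human ruling 2026-08-16: every hypothesis of closes is a crux; supports must be PROVED lemmas): it
is an unproved load-bearing hypothesis of closes, not dischargeable in Lean short of proving the
vendored fact Temkin2013Relative (itself reduced in tree to the unproved leaf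
Temkin2013RelativeCurveSmoothFibre) (why it might fail: the Frobenius transport for [k:k^p] = ∞ is
unpublished and meets InseparableBaseChange — smooth ≠ regular — head-on; Temkin's refining model X′
need not dominate the given R; the naive descent to an F-finite subfield fails, see its docstring).
SUPPORT: #4 TorsorToLurelFfinite — the same for [k : k^p] < ∞, Rem 1.5(ii) verbatim; #5 RankOneRel
and RankOneRelOfNS2014 — rank-one reduction of LUrel_p (NovacoskiSpivakovsky2014 Thm 1.1, PROVED in
tree; ~300 lines of translation glue), letting work on #2/#3 restrict to rank-one O; #9
LurelOfResolution — ResolutionInChar p → LUrel_p (faithfulness: the target is EQUIVALENT to the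
summit prime by prime; valuative criterion of properness + an affine chart at the centre). TARGET #0
ValuativeThesisRel = X; ASSEMBLIES #1: Assembly = the absolute frame (∀ p prime, LU_p ∧ (LU_p →
ResolutionInChar p)) → summit, PROVED (Assembly_holds); Assembly2 = the relative frame X → summit
(stmt-0640; its statement is proved in tree by
Literature.AlgGeom.resolutionOfSingularities_of_relLocalUniformization_and_patching — dischargeable
now by `workitem close --as proved --by`). Both are PROVED (Assembly_holds, Assembly2_holds; 0640
closed 2026-08-15T18:28Z) and redundant with the deciding theorem; the residual needs_repair stamp
route.multi-assembly is not planner-repairable (re-tried 2026-08-16: the gate refuses --drop and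
--retriage on assembly-kind items and --restate keeps the kind and must differ from every other
item) — ROUTE-CHOICE VERDICT 2026-08-16: conforms in substance, gate/operator re-evaluation
requested: drop or re-kind the superseded entry stmt-0559 Assembly (keep Assembly2 = X → Statement
of the live thesis), or ignore closed+proved assembly entries not referenced by closes. SUPERSEDED
(absolute-form) items still in the file for the same reason: ValuativeThesis (0558), Lupi (0560),
Patching (0561), LupiToLu (0562), RankOneReduction (0563) — do not seat anyone on them; drop at the
first edit the gate allows. Deciding theorem: closes (h₂ : LuAlphaPTorsor) (h₄ : TorsorToLurel) (h₃
: PatchingRel) : ResolutionOfSingularities := fun p hp => h₃ p hp (h₄ p hp (h₂ p hp)).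
KILL CRITERIA. ¬LuAlphaPTorsor is morally ¬LU_p, i.e. (via LurelOfResolution) ¬summit in that
characteristic: a PROBLEM DECIDER — file the witness as a refutation with evidence, do not merely
close the route. The route is CLOSED (refuted:PatchingRel) if PatchingRel is refuted in this
non-embedded form AND no embedded variant (finite Z ⊆ R made monomial in a regular system of
parameters, NovacoskiSpivakovsky2014 Thm 1.2/1.3 style) elaborates as a replacement; it is DEMOTED
below route CyclicCovers if the torsor case turns out to need the Artin–Schreier case anyway
(Temkin's reduction trades AS for PI at the cost of enlarging K); TorsorToLurel refuted-misstated ⇒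
repair from Temkin2013Relative's exact conclusion; TorsorToLurel refuted-substantive (Temkin's
theorem does not give the k-model) ⇒ pivot to the F-finite thesis (TorsorToLurelFfinite) plus an
explicit F-finite → general crux with SMOOTH centres.
NOT DECOMPOSED YET. Sub-cruxes of LuAlphaPTorsor: rank-one O first (via RankOneRel), defectless vs
immediate/defect case (Kuhlmann's henselian rationality, key polynomials), the birational sub-case t
∈ Frac A₀ ∖ (A₀)_centre (principalization over a regular n-fold), dimension ≤ 3 from
CossartPiltant2008/2009 as a special case; the real inputs of PatchingRel (simultaneous LU for
finitely many valuations, embedded LUrel with normal crossings, Piltant2013's axioms, dimension ≤ 3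
from (h : CossartPiltant2019) LU-free); the Lean discharge of TorsorToLurel from Temkin2013Relative
(Frobenius transport, smooth base change of the centre, normality). All are layer-2 children once #2
or #3 moves (D-0019).
CHEAPEST FALSIFIER. A lookup, not a computation: open Piltant2013 (doi:10.1007/s13398-012-0090-6,
acq-00006) / CossartPiltant2008 Prop 4.7-4.9 and check whether the dimension-3 patching consumes
plain LU (regular local model dominating R) or EMBEDDED LU with a normal-crossings condition on a
prescribed finite set; if the latter, PatchingRel as stated is not even the known dimension-3
theorem and must be superseded by the embedded antecedent before anyone is seated on it. Second
cheapest: instantiate LuAlphaPTorsor at dim A₀ = 1, k imperfect (t^p = a(x) a curve over k): the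
normalisation of A₀[t] is f.g. and regular (excellence), consistent — a refuter should confirm the
statement's side conditions (t^p ∈ A₀, IsFractionRing (adjoin k (insert t A₀)) K) exclude nothing
intended.
SOURCES. Temkin2013 = arXiv:0804.1554 (Thm 1.2, Rem 1.5, pp.3-4 read 2026-08-15);
NovacoskiSpivakovsky2014 = arXiv:1204.4751; CutkoskyMourtada2019 = arXiv:1711.02726;
CossartPiltant2008 doi:10.1016/j.jalgebra.2008.03.032; CossartPiltant2009; CossartPiltant2019;
Piltant2013 doi:10.1007/s13398-012-0090-6; KnafKuhlmann2005; ZariskiSamuel1960 VI.17;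
Literature.Barriers.ResolutionOfSingularities.{DimensionFourFrontier, InseparableBaseChange}.

Novelty: NOVELTY (retriage 2026-08-14; searched lit frontier --since 2020, lit search "local uniformization
positive characteristic valuation" (local+S2/zbMATH/Crossref; OpenAlex/arXiv rate-limited), lit
search --hybrid purely-inseparable/defect LU, lit read arXiv:0804.1554 pp.3-4, arXiv:1711.02726
pp.3-4, arXiv:2507.06743, barrier catalogue (9), tree Literature/AlgebraicGeometry/Resolution).
Nearest prior art: the line IS Zariski's programme (LU along every valuation + quasi-compact
patching, ZariskiSamuel1960 VI.17) as executed in dim 3, char p, by CossartPiltant2008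
(doi:10.1016/j.jalgebra.2008.03.032 Thm 2.1 reduction to LU on Artin-Schreier/purely inseparable
degree-p coverings of a regular germ, Prop 4.9 patching), CossartPiltant2009, CossartPiltant2019;
the local half is organised exactly as Temkin2013 Rem 1.3.5(ii)-(iii) proposes ("if we know how to
uniformize valuations on alpha_p-torsors over regular schemes"; inseparable case t^p = f), with the
dimension-free reductions NovacoskiSpivakovsky2014 Thm 1.1 (PROVED in tree:
NovacoskiSpivakovsky2014_holds), KnafKuhlmann2005, KnafKuhlmann2009, CutkoskyMourtada2019 (defect =
the obstruction, ELU_4 unknown); ind-regular variants Popescu arXiv:2507.06743. Delta: NO new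
mechanism (expected grade known/variant). New only as interface: relative LU typed over Mathlib's
ValuationSubring (f.g.-subalgebra domination = one local blowing-up, NS2014 Def 2.11/2.20);
alpha_p-torsor LU over a regular base isolated as the single local crux; Temkin  [refs: 10.1016/j.jalgebra.2008.03.032, 0804.1554, 1711.02726, 2507.06743, doi:10.1016/j.jalgebra.2008.03.032, ZariskiSamuel1960, CossartPiltant2008, CossartPiltant2009, CossartPiltant2019, Temkin2013, NovacoskiSpivakovsky2014, KnafKuhlmann2005, KnafKuhlmann2009, CutkoskyMourtada2019]

Barriers (technique_class: local-uniformization zariski-patching alpha-p-torsor defect): BARRIERS (Literature/Barriers/ResolutionOfSingularities, 9 entries examined; technique_class: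
local-uniformization zariski-patching alpha-p-torsor defect).
- Literature.Barriers.ResolutionOfSingularities.DimensionFourFrontier: APPLIES squarely; cruxes
LuAlphaPTorsor / PatchingRel are special forms of its missing inputs LU_4
(LocalUniformizationUpToDim k 4) and ZariskiPatchingUpToDim >= 4. Not evaded. Bet: the torsor form
(ONE purely inseparable hypersurface t^p = a over a base regular at the centre, ONE valuation, rank
one by NS2014) is a smaller target than ELU_4 and open to dimension-free valuation theory (defect,
Kuhlmann2010 stability, key polynomials/Perron transforms) rather than CP polyhedra. PatchingRel: no
evasion (open even in char 0 independently of Hironaka, CutkoskyMourtada2019 p.3); flagged possibly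
summit-hard.
- Literature.Barriers.ResolutionOfSingularities.InseparableBaseChange: evaded for smooth-vs-regular
in the CONCLUSIONS (all items conclude IsRegularLocalRing over the given k, never after base change)
and now MET HEAD-ON in the reduction: the deciding theorem consumes TorsorToLurel (all k), whose
proof must use l-SMOOTH centres (Temkin2013Relative) because regular-only models over an F-finite
subfield k₁ ⊆ k do not base-change (some (k, S) admit no F-finite k₁ ∋ S with k/k₁ separable: k = ∪ₙ
F_p(s,u₁,u₂,…)(wₙ), w_{n+1}^p = wₙ − u_{n+1}^p s, S = {s, w₀}); TorsorToLurelFfinite keeps the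
F-finite special case where Temkin's Rem 1.5(ii) applies verbatim.
- L

Novelty grade: known — Route-review grade (refuter rreview1, 2026-08-15; based on the planner's documented 2026-08-14 search, the tree Literature/AlgebraicGeometry/Resolution and the 9-entry barrier catalogue; lit searchd rc 75 throughout this session, no fresh remote query). KNOWN: the line is Zariski's programme (LU alo (refuter refuter-rreview1-ResolutionOfSingularities-Valu-79a0b988-0, 2026-08-15T18:30:16Z; prior: arXiv:0804.1554 (Temkin2013) Rem 1.3.5(ii)-(iii): LU_p from LU of alpha_p-torsors t^p=a over regular schemes, doi:10.1016/j.jalgebra.2008.03.032 (CossartPiltant2008) Thm 2.1 + Prop 4.9: reduction to AS/purely-inseparable coverings + Zariski patching, dim 3, Zariski 1944 Ann. Math. 45 / ZariskiSamuel1960 VI.17: LU + quasi-compact patching programme, arXiv:1204.4751 (NovacoskiSpivakovsky2014) Thm 1.)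

History (route lifecycle, newest last):
- 2026-08-16T14:15:59Z · LINT AUTOFIX: dropped duplicate assembly item(s) Assembly2 (kept the one `closes` uses) (operator:gate4)
- 2026-08-24T15:58:32Z · DORMANT — reconciler: no traction for 6.9 d (last activity item-evidence-added at 2026-08-17T18:22:14Z); parked, not closed — `ledger route dormant route-ResolutionOfSing (operator:999:2488438)
- 2026-08-26T21:02:32Z · REACTIVATED — reconciler: reactivated — activity item-evidence-added at 2026-08-26T20:04:10Z after parking at 2026-08-24T15:58:32Z (operator:999:1183297)

sub-problem: ResolutionOfSingularities · status: open · opened planner-ResolutionOfSingularities-Survey-0 2026-08-13T13:06:08Z · rev 13 · ledger route-ResolutionOfSingularities-Valuative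
GENERATED by the gate from the ledger (D-0016/17). Provers cite these decls: `theorem foo : Summit.ResolutionOfSingularities.ResolutionOfSingularities.Theses.Valuative.<Decl> := …` in Summits/ResolutionOfSingularities/ResolutionOfSingularities/Theorems/<Name>.lean.
-/

namespace Summit.ResolutionOfSingularities.ResolutionOfSingularities.Theses.Valuative

open scoped BigOperators Topology Manifold Classical MeasureTheory ProbabilityTheory Matrix InnerProductSpace ComplexConjugate ContinuousMap
open Filter Set Function TopologicalSpace MeasureTheory

attribute [summit_statement] _root_.ResolutionOfSingularities

/-! Retired items kept as plain definitions (history; not obligations of this route): landed proofs / closed glue still name them. -/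

/-- retired stmt-ResolutionOfSingularities-0640 (dropped, gen None) — proved by Literature.AlgGeom.resolutionOfSingularities_of_relLocalUniformization_and_patching. -/
def Assembly2 : Prop :=
  (∀ p : ℕ, p.Prime → (∀ (k K : Type) [Field k] [CharP k p] [Field K] [Algebra k K], (⊤ : IntermediateField k K).FG → ∀ O : ValuationSubring K, (∀ c : k, algebraMap k K c ∈ O) → ∀ R : Subalgebra k K, R.FG → R.toSubring ≤ O.toSubring → ∃ (A : Subalgebra k K) (h : A.toSubring ≤ O.toSubring), R ≤ A ∧ A.FG ∧ IsFractionRing A K ∧ IsRegularLocalRing (Localization.AtPrime (Ideal.comap (Subring.inclusion h) (IsLocalRing.maximalIdeal O)))) ∧ ((∀ (k K : Type) [Field k] [CharP k p] [Field K] [Algebra k K], (⊤ : IntermediateField k K).FG → ∀ O : ValuationSubring K, (∀ c : k, algebraMap k K c ∈ O) → ∀ R : Subalgebra k K, R.FG → R.toSubring ≤ O.toSubring → ∃ (A : Subalgebra k K) (h : A.toSubring ≤ O.toSubring), R ≤ A ∧ A.FG ∧ IsFractionRing A K ∧ IsRegularLocalRing (Localization.AtPrime (Ideal.comap (Subring.inclusion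 h) (IsLocalRing.maximalIdeal O)))) → Literature.AlgebraicGeometry.Resolution.ResolutionInChar.{0} p)) → _root_.ResolutionOfSingularities

/-- item stmt-ResolutionOfSingularities-0639 · target · rank 0 · open · by planner
why it might fail: Equivalent to the char-p summit (LUrel_p ⇐ Res_p via ResolutionInChar.relLocalUniformization; PatchingRel_p ⇐ Res_p): fails iff resolution fails in some char p; both conjuncts open in trdeg ≥ 4 (NS2014 p.1; Temkin2013 p.3).
sources: Literature.AlgebraicGeometry.Resolution.ResolutionInChar.relLocalUniformization (ResolutionLU.lean:475), NovacoskiSpivakovsky2014 = arXiv:1204.4751 p.1 ('local uniformization in arbitrary dimension and characteristic remains an open problem'), Temkin2013 = arXiv:0804.1554 §1.2 p.3, Literature.AlgGeom.resolutionOfSingularities_of_relLocalUniformization_and_patching (proves assembly 0640's statement; item 0640 still open in the ledger)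
PIVOT (supersedes stmt-0558). For every prime p: LUrel_p — RELATIVE Zariski local uniformization in
char p: for every finitely generated K/k (char k = p), every valuation ring O of K containing k and
every finitely generated k-subalgebra R ⊆ O there is a finitely generated k-subalgebra A with R ⊆ A
⊆ O, Frac A = K and A localised at the centre m_O ∩ A regular (R ≤ A ⊆ O = one local blowing-up
along an ideal, NovacoskiSpivakovsky2014 Def 2.11/2.20; = Temkin2013 'affine model X′ refining X') —
AND PatchingRel_p: LUrel_p → ResolutionInChar p. Relative ⇒ absolute by R := ⊥ (Sketch.lean);
LUrel_p ⇐ ResolutionInChar p (resolve Spec R[gens], take the chart containing the centre), so the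
thesis is faithful. -/
@[route_item "route-ResolutionOfSingularities-Valuative", crux]
def ValuativeThesisRel : Prop :=
  ∀ p : ℕ, p.Prime → (∀ (k K : Type) [Field k] [CharP k p] [Field K] [Algebra k K], (⊤ : IntermediateField k K).FG → ∀ O : ValuationSubring K, (∀ c : k, algebraMap k K c ∈ O) → ∀ R : Subalgebra k K, R.FG → R.toSubring ≤ O.toSubring → ∃ (A : Subalgebra k K) (h : A.toSubring ≤ O.toSubring), R ≤ A ∧ A.FG ∧ IsFractionRing A K ∧ IsRegularLocalRing (Localization.AtPrime (Ideal.comap (Subring.inclusion h) (IsLocalRing.maximalIdeal O)))) ∧ ((∀ (k K : Type) [Field k] [CharP k p] [Field K] [Algebra k K], (⊤ : IntermediateField k K).FG → ∀ O : ValuationSubring K, (∀ c : k, algebraMap k K c ∈ O) → ∀ R : Subalgebra k K, R.FG → R.toSubring ≤ O.toSubring → ∃ (A : Subalgebra k K) (h : A.toSubring ≤ O.toSubring), R ≤ A ∧ A.FG ∧ IsFractionRing A K ∧ IsRegularLocalRing (Localization.AtPrime (Ideal.comap (Subring.inclusion h) (IsLocalRing.maximalIdeal O)))) → Literature.AlgebraicGeometry.Resolution.ResolutionInChar.{0}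 p)

/-- item stmt-ResolutionOfSingularities-0641 · crux · rank 2 · open · by planner
why it might fail: Live case t∉Frac A₀ = LU of t^p=a in a regular (n+1)-fold along any O: OPEN for n≥4, all p (Temkin Rem 1.3.5 'all bad things happen'; CutkoskyMourtada2019: ELU unknown in dim 4); residual order of z^{p^e}+F diverges in A^5 (HauserPerlega2019); t∈Frac A₀∖(A₀)_c hides principalization
sources: Temkin2013 = arXiv:0804.1554 Rem 1.3.5(ii)-(iii) p.4 ('if we know how to uniformize valuations on alpha_p-torsors over regular schemes'; inseparable case t^p = f), CutkoskyMourtada2019 = arXiv:1711.02726 §1 pp.3-4 ('All of the above proofs of LU in dimension m ≥ 3 require ELU'; 'we do not know ELU in dimension 4'), Literature.Barriers.ResolutionOfSingularities.DimensionFourFrontier (LocalUniformizationUpToDim k 4 = missing input LU_4), Literature.Barriers.ResolutionOfSingularities.hauserPerlega_mohProofBoundFails (HauserPerlega2019 §3-4: z^{p^3}+F(x,y,v,w) in A^5, residual order unbounded under point blow-ups), CossartPiltant2008 doi:10.1016/j.jalgebra.2008.03.032 eq.(1) p.2 + CossartPiltant2009 Main Thm pp.4-5 (dim-3 case known); Literature.AlgebraicGeometry.Resolution.CossartPiltant2019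 in tree, refuter-refute-pool-g3-0 note 2026-08-13 on 0641 (birational sub-case t ∈ Frac A₀ ∖ (A₀)_centre needs principalization over a regular n-fold)
THE CRUX (supersedes stmt-0560 LUPI). Relative local uniformization of α_p-TORSORS over a regular
base (Temkin2013 = arXiv:0804.1554 Rem 1.3.5(ii)-(iii), 'if we know how to uniformize valuations on
α_p-torsors over regular schemes…'): k of char p, O a valuation ring of K, A₀ ⊆ O a finitely
generated k-subalgebra REGULAR AT THE CENTRE m_O ∩ A₀, t ∈ K with t^p ∈ A₀ and Frac(A₀[t]) = K (so
[K : Frac A₀] ∈ {1, p}, purely inseparable). CLAIM: there is a finitely generated k-subalgebra A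
with A₀[t] ⊆ A ⊆ O, Frac A = K, A regular at the centre. Degenerate case t ∈ Frac A₀ is true via
'regular local ⇒ normal' (A := A₀[t] localises to (A₀)_centre). Live case = Zariski hypersurface t^p
= a over a regular local ring of dim n; known n ≤ 3 (CossartPiltant2008/2009 inseparable case g =
0), OPEN n ≥ 4. ¬(this) is morally ¬LU_p, a problem decider rather than a route killer. -/
@[route_item "route-ResolutionOfSingularities-Valuative", crux]
def LuAlphaPTorsor : Prop :=
  ∀ p : ℕ, p.Prime → ∀ (k K : Type) [Field k] [CharP k p] [Field K] [Algebra k K] (O : ValuationSubring K) (A₀ : Subalgebra k K) (h₀ : A₀.toSubring ≤ O.toSubring) (t : K), A₀.FG → t ^ p ∈ A₀ → IsFractionRing (Algebra.adjoin k (insert t (A₀ : Set K))) K → IsRegularLocalRing (Localization.AtPrime (Ideal.comap (Subring.inclusion h₀) (IsLocalRing.maximalIdeal O))) → ∃ (A : Subalgebra k K) (h : A.toSubring ≤ O.toSubring), A₀ ≤ A ∧ t ∈ A ∧ A.FG ∧ IsFractionRing A K ∧ IsRegularLocalRing (Localization.AtPrime (Ideal.comap (Subring.inclusion h) (IsLocalRing.maximalIdeal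 O)))

/-- item stmt-ResolutionOfSingularities-0642 · crux · rank 3 · open · by planner
why it might fail: Patching LUs into ONE proper regular model: known only in dim ≤3 (Zariski; CP2008 Prop 4.9/Piltant2013 need surface factorisation + embedded resolution in a regular 3-fold); in dim ≥4 no reduction Res⇐LU exists even in char 0 (CutkoskyMourtada2019 p.3): maybe summit-hard; plain LUrel may be too weak
sources: CutkoskyMourtada2019 = arXiv:1711.02726 §1 p.3 ('there still is not a direct proof (even in characteristic zero) that a set of local uniformizations can be birationally modified so that they patch together'), Temkin2013 = arXiv:0804.1554 §1.2 (v3 p.2: 'it is unknown if one can reduce global desingularization to local uniformization in higher dimensions'; held copy p.3: 'he could deduce global desingularization only for threefolds'), CossartPiltant2008 doi:10.1016/j.jalgebra.2008.03.032 Prop 4.9 pp.16-17 (refined patching, trdeg 3; inputs Prop 4.7 factorisation, Prop 4.8 embedded resolution in a regular 3-fold), Piltant2013 doi:10.1007/s13398-012-0090-6 (axiomatic Zariski patching; paywalled, acq-00006), NovacoskiSpivakovsky2016 doi:10.4064/bc108-0-17 §1 (resolution and LU open in dim > 3, char p), Literature.Barriers.ResolutionOfSingularities.DimensionFourFrontier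 (ZariskiPatchingUpToDim 4 isolated as missing input; in tree: Literature.AlgebraicGeometry.Resolution.ZariskiRiemannSpace.compactSpace, CossartPiltant2019Patching)
PatchingRel_p (supersedes stmt-0561 for this route): RELATIVE local uniformization LUrel_p (all f.g.
K/k with char k = p, all valuation rings O ⊇ k, all f.g. R ⊆ O dominated) implies ResolutionInChar
p. Zariski's patching: fix a projective model X, LUrel gives for each O ∈ RZ(X) a regular model
dominating X near the centre, quasi-compactness of RZ(X) gives finitely many, then DOMINATE/glue
them into one proper regular model of X — known dim 2 (Zariski 1939), dim 3 (Zariski 1944 char 0;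
CossartPiltant2008/2009 + Piltant2013 axiomatics in char p), OPEN as an implication in dim ≥ 4 (the
glueing step uses resolution/principalization in dimension n−1). Refuters: say whether weak-EMBEDDED
LUrel (finite Z ⊆ R made monomial in a regular system of parameters, NovacoskiSpivakovsky2014 Thm
1.2/1.3) is what Piltant2013's axioms actually consume; if so the planner supersedes with the
embedded antecedent. Lean-side: needs centre of a valuation on a proper k-scheme, RZ space, blow-ups
— none in Mathlib; with (h : CossartPiltant2019) the dim ≤ 3 sub-case is immediate and LU-free. -/
@[route_item "route-ResolutionOfSingularities-Valuative", crux]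
def PatchingRel : Prop :=
  ∀ p : ℕ, p.Prime → (∀ (k K : Type) [Field k] [CharP k p] [Field K] [Algebra k K], (⊤ : IntermediateField k K).FG → ∀ O : ValuationSubring K, (∀ c : k, algebraMap k K c ∈ O) → ∀ R : Subalgebra k K, R.FG → R.toSubring ≤ O.toSubring → ∃ (A : Subalgebra k K) (h : A.toSubring ≤ O.toSubring), R ≤ A ∧ A.FG ∧ IsFractionRing A K ∧ IsRegularLocalRing (Localization.AtPrime (Ideal.comap (Subring.inclusion h) (IsLocalRing.maximalIdeal O)))) → Literature.AlgebraicGeometry.Resolution.ResolutionInChar.{0} p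

/-- item stmt-ResolutionOfSingularities-10968 · crux · rank 4 · open · by planner
why it might fail: Unproved for ALL k: rests on Temkin2013 Thm 1.3.2 (fact Temkin2013Relative, reduced in tree to the UNPROVED leaf Temkin2013RelativeCurveSmoothFibre) + an unpublished Frobenius transport over k·L^{p^n} for [k:k^p]=∞ (smooth≠regular: InseparableBaseChange); Temkin's X′ need not dominate the given R
sources: arXiv:0804.1554 (Temkin2013) Thm 1.2 = Thm 1.3.2 of v3, Rem 1.5(i)-(ii) p.4, Literature.AlgebraicGeometry.Resolution.Temkin2013Relative (vendored fact; in-tree reduction to the unproved leaf Temkin2013RelativeCurveSmoothFibre), Literature.Barriers.ResolutionOfSingularities.InseparableBaseChange, refuter rreview1 CHECKED note 2026-08-15T18:27Z on stmt-10968 (on-paper derivation sound modulo Temkin2013Relative; hidden dependency on the unproved leaf)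
[support] Temkin's reduction for EVERY ground field k of char p (the item the deciding theorem
`closes` consumes; TorsorToLurelFfinite = stmt-0643 stays as the F-finite special case): LU for
α_p-torsors over bases regular at the centre (crux LuAlphaPTorsor, stated for all k) ⇒ RELATIVE LU_p
for all f.g. K/k, all valuation rings O ⊇ k, all f.g. R ⊆ O. On paper: enlarge R to R[y] with Frac =
K; Temkin2013 = arXiv:0804.1554 Thm 1.2 (= Thm 1.3.2 of v3; NO [k:k^p] hypothesis; vendored as
Literature.AlgebraicGeometry.Resolution.Temkin2013Relative) gives finite purely inseparable l/k,
L/lK, an affine model A′ ⊇ R[y] of K° and the centre of L° on N = Nr_L(A′) simple and l-SMOOTH; Rem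
1.5(i): with L^{p^n} ⊆ K and l^{p^n} ⊆ k, Frobenius makes A₀ := N^{p^n} ⊆ K a f.g. l^{p^n}-algebra,
smooth over l^{p^n} at the centre of O; k[A₀] ⊆ O is regular at the centre because (A₀ ⊗_{l^{p^n}}
k)_𝔮 is smooth over k, hence a regular local DOMAIN, so the kernel of A₀ ⊗ k → K (contained in a
minimal prime by equidimensionality d = trdeg) vanishes at 𝔮 — this is where smoothness (not mere
regularity) is used and why no F-finiteness is needed; Rem 1.5(ii) with k·L^{p^n} in place of
L^{p^n}: [K : k·K^{p^n}] < -/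
@[route_item "route-ResolutionOfSingularities-Valuative", crux]
def TorsorToLurel : Prop :=
  ∀ p : ℕ, p.Prime → (∀ (k K : Type) [Field k] [CharP k p] [Field K] [Algebra k K] (O : ValuationSubring K) (A₀ : Subalgebra k K) (h₀ : A₀.toSubring ≤ O.toSubring) (t : K), A₀.FG → t ^ p ∈ A₀ → IsFractionRing (Algebra.adjoin k (insert t (A₀ : Set K))) K → IsRegularLocalRing (Localization.AtPrime (Ideal.comap (Subring.inclusion h₀) (IsLocalRing.maximalIdeal O))) → ∃ (A : Subalgebra k K) (h : A.toSubring ≤ O.toSubring), A₀ ≤ A ∧ t ∈ A ∧ A.FG ∧ IsFractionRing A K ∧ IsRegularLocalRing (Localization.AtPrime (Ideal.comap (Subring.inclusion h) (IsLocalRing.maximalIdeal O)))) → ∀ (k K : Type) [Field k] [CharP k p] [Field K] [Algebra k K], (⊤ : IntermediateField k K).FG → ∀ O : ValuationSubring K, (∀ c : k, algebraMap k K c ∈ O) → ∀ R : Subalgebra k K, R.FG → R.toSubring ≤ O.toSubring → ∃ (A : Subalgebra k K) (h : A.toSubring ≤ O.toSubring), R ≤ A ∧ A.FG ∧ IsFractionRing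 A K ∧ IsRegularLocalRing (Localization.AtPrime (Ideal.comap (Subring.inclusion h) (IsLocalRing.maximalIdeal O)))

/-- item stmt-ResolutionOfSingularities-0558 · support · rank 0 · open · by planner
why it might fail: Fails iff ResolutionInChar p fails for some prime p (Res_p ⇒ LU_p, so no independent failure mode): a problem decider; open in dim ≥ 4 (Temkin2013 p.3: 'dim(X) > 3 is widely open').
sources: Literature.AlgebraicGeometry.Resolution.ResolutionInChar.localUniformizationInChar (Literature/AlgebraicGeometry/Resolution/ResolutionLU.lean:485: Res_p ⇒ absolute LU_p), Temkin2013 = arXiv:0804.1554 §1.2 (held copy p.3), Literature.AlgGeom.resolutionOfSingularities_of_localUniformization_and_patching (assembly 0559 proved)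
For every prime p: LU_p (every valuation ring O ⊇ k of a finitely generated field K/k, char k = p,
contains a finitely generated k-subalgebra A with Frac A = K and A localised at m_O ∩ A regular) and
Patching_p (LU_p -> ResolutionInChar p). -/
@[route_item "route-ResolutionOfSingularities-Valuative", crux]
def ValuativeThesis : Prop :=
  ∀ p : ℕ, p.Prime → (∀ (k K : Type) [Field k] [CharP k p] [Field K] [Algebra k K], (⊤ : IntermediateField k K).FG → ∀ O : ValuationSubring K, (∀ c : k, algebraMap k K c ∈ O) → ∃ (A : Subalgebra k K) (h : A.toSubring ≤ O.toSubring), A.FG ∧ IsFractionRing A K ∧ IsRegularLocalRing (Localization.AtPrime (Ideal.comap (Subring.inclusion h) (IsLocalRing.maximalIdeal O)))) ∧ ((∀ (k K : Type) [Field k] [CharP k p] [Field K] [Algebra k K], (⊤ : IntermediateField k K).FG → ∀ O : ValuationSubring K, (∀ c : k, algebraMap k K c ∈ O) → ∃ (A : Subalgebra k K) (h : A.toSubring ≤ O.toSubring), A.FG ∧ IsFractionRing A K ∧ IsRegularLocalRing (Localization.AtPrime (Ideal.comap (Subring.inclusion h) (IsLocalRing.maximalIdeal O)))) → Literature.AlgebraicGeometry.Resolution.ResolutionInChar.{0}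 p)

/-- item stmt-ResolutionOfSingularities-0560 · support · rank 2 · open · by planner
LUPI_p: local uniformization for purely inseparable hypersurface function fields: K generated over k
(char p) by algebraically independent x_1..x_n and t with t^p in k[x]; every valuation ring O ⊇ k of
K admits a finitely generated k-subalgebra A ⊆ O, Frac A = K, with A_(m_O ∩ A) regular. By
Temkin2013 Rem 1.3.4(iii) this implies LU_p. Open for n >= 4. -/
@[route_item "route-ResolutionOfSingularities-Valuative", crux]
def Lupi : Prop :=
  ∀ p : ℕ, p.Prime → ∀ (k K : Type) [Field k] [CharP k p] [Field K] [Algebra k K] (n : ℕ) (x : Fin n → K) (t : K), AlgebraicIndependent k x → t ^ p ∈ Algebra.adjoin k (Set.range x) → IntermediateField.adjoin k (insert t (Set.range x)) = ⊤ → ∀ O : ValuationSubring K, (∀ c : k, algebraMap k K c ∈ O) → ∃ (A : Subalgebra k K) (h : A.toSubring ≤ O.toSubring), A.FG ∧ IsFractionRing A K ∧ IsRegularLocalRing (Localization.AtPrime (Ideal.comap (Subring.inclusion h) (IsLocalRing.maximalIdeal O)))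

/-- item stmt-ResolutionOfSingularities-0561 · support · rank 3 · open · by planner
Patching_p: local uniformization in char p (LU_p, all finitely generated K/k and all valuation
rings) implies ResolutionInChar p. Zariski's patching is known in dim <= 3 (Zariski; Piltant2013
axiomatic version used by CossartPiltant2008); open as an implication in dim >= 4. A refuter should
check whether the non-embedded LU stated here is too weak for any patching argument
(embedded/simultaneous LU may be needed). -/
@[route_item "route-ResolutionOfSingularities-Valuative", crux]
def Patching : Prop :=
  ∀ p : ℕ, p.Prime → (∀ (k K : Type) [Field k] [CharP k p] [Field K] [Algebra k K], (⊤ : IntermediateField k K).FG → ∀ O : ValuationSubring K, (∀ c : k, algebraMap k K c ∈ O) → ∃ (A : Subalgebra k K) (h : A.toSubring ≤ O.toSubring), A.FG ∧ IsFractionRing A K ∧ IsRegularLocalRing (Localization.AtPrime (Ideal.comap (Subring.inclusion h) (IsLocalRing.maximalIdeal O)))) → Literature.AlgebraicGeometry.Resolution.ResolutionInChar.{0} p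

/-- item stmt-ResolutionOfSingularities-0562 · support · rank 4 · open · by planner
LUPI_p -> LU_p: Temkin's reduction of local uniformization to the purely inseparable hypersurface
case (Temkin2013 Thm 1.3.2 + Rem 1.3.4(iii): uniformize after a purely inseparable extension L/K,
filter L/K in degree-p steps t^p = f, descend step by step using LUPI). Expected to become
conditional on a vendored fact Temkin2013 Thm 1.3.2. -/
@[route_item "route-ResolutionOfSingularities-Valuative", crux]
def LupiToLu : Prop :=
  ∀ p : ℕ, p.Prime → (∀ (k K : Type) [Field k] [CharP k p] [Field K] [Algebra k K] (n : ℕ) (x : Fin n → K) (t : K), AlgebraicIndependent k x → t ^ p ∈ Algebra.adjoin k (Set.range x) → IntermediateField.adjoin k (insert t (Set.range x)) = ⊤ → ∀ O : ValuationSubring K, (∀ c : k, algebraMap k K c ∈ O) → ∃ (A : Subalgebra k K) (h : A.toSubring ≤ O.toSubring), A.FG ∧ IsFractionRing A K ∧ IsRegularLocalRing (Localization.AtPrime (Ideal.comap (Subring.inclusion h) (IsLocalRing.maximalIdeal O)))) → ∀ (k K : Type) [Field k] [CharP k p] [Field K] [Algebra k K], (⊤ : IntermediateField k K).FG → ∀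 O : ValuationSubring K, (∀ c : k, algebraMap k K c ∈ O) → ∃ (A : Subalgebra k K) (h : A.toSubring ≤ O.toSubring), A.FG ∧ IsFractionRing A K ∧ IsRegularLocalRing (Localization.AtPrime (Ideal.comap (Subring.inclusion h) (IsLocalRing.maximalIdeal O)))

/-- item stmt-ResolutionOfSingularities-0643 · support · rank 4 · open · by planner
Temkin's reduction, honest form (supersedes stmt-0562): LU for α_p-torsors over regular bases
(rank-2 crux, all k of char p) implies RELATIVE LU for every base field k with [k : k^p] < ∞ (typed:
Module.Finite (frobenius k p).range k; covers perfect k and all k f.g. over F_p). On paper a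
corollary of Temkin2013 (arXiv:0804.1554) Thm 1.3.2 p.3 (inseparable LU: given an affine model X =
Spec R of K° there are finite purely inseparable l/k, L/lK and an affine model X′ refining X with
K°_L centred at an l-smooth point of Nr_L(X′)) + Rem 1.3.5(i)-(ii) p.4: Frobenius F^n moves Nr_L(X′)
to a regular f.g. model A_0 of K_0 = L^{p^n} ⊆ K over k′ := k^{p^n} ([k : k′] < ∞ needed for
finiteness); tower K_0 ⊂ K_1 ⊂ … ⊂ K_m = K, K_i = K_{i−1}(a_i^{1/p}); each step is one application
of the torsor crux over base field k′ (given f.g. R_i ⊆ O ∩ K_i: R_i^p ⊆ K_{i−1}, uniformize K_{i−1}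
relative to k′[R_i^p, a_i], apply the crux with t = a generator, then absorb the remaining p-th
roots R_i into A by normality of the regular centre); finally k ⊆ (A_m)_centre by integrality +
normality, so A_m[k] is the wanted k-model. Expected to be re-filed as (h : Temkin2013_1_3_2) → …
once the grounder vendors Thm 1 -/
@[route_item "route-ResolutionOfSingularities-Valuative", crux]
def TorsorToLurelFfinite : Prop :=
  ∀ (p : ℕ) [Fact p.Prime], (∀ (k K : Type) [Field k] [CharP k p] [Field K] [Algebra k K] (O : ValuationSubring K) (A₀ : Subalgebra k K) (h₀ : A₀.toSubring ≤ O.toSubring) (t : K), A₀.FG → t ^ p ∈ A₀ → IsFractionRing (Algebra.adjoin k (insert t (A₀ : Set K))) K → IsRegularLocalRing (Localization.AtPrime (Ideal.comap (Subring.inclusion h₀) (IsLocalRing.maximalIdeal O))) → ∃ (A : Subalgebra k K) (h : A.toSubring ≤ O.toSubring), A₀ ≤ A ∧ t ∈ A ∧ A.FG ∧ IsFractionRing A K ∧ IsRegularLocalRing (Localization.AtPrime (Ideal.comap (Subring.inclusion h) (IsLocalRing.maximalIdeal O)))) → ∀ (k K : Type) [Field k] [CharP k p] [Field K] [Algebra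 k K], Module.Finite (frobenius k p).range k → (⊤ : IntermediateField k K).FG → ∀ O : ValuationSubring K, (∀ c : k, algebraMap k K c ∈ O) → ∀ R : Subalgebra k K, R.FG → R.toSubring ≤ O.toSubring → ∃ (A : Subalgebra k K) (h : A.toSubring ≤ O.toSubring), R ≤ A ∧ A.FG ∧ IsFractionRing A K ∧ IsRegularLocalRing (Localization.AtPrime (Ideal.comap (Subring.inclusion h) (IsLocalRing.maximalIdeal O)))

/-- item stmt-ResolutionOfSingularities-0563 · support · rank 5 · closed · proved by Summit.ResolutionOfSingularities.ResolutionOfSingularities.Theorems.rankOneReduction_proof @ d76d53008079 (prover) · by planner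
RankOne_p: if LU holds for all rank-one valuation rings (Nonempty O.valuation.RankOne) of finitely
generated K/k, char k = p, then LU_p holds for all valuation rings. NovacoskiSpivakovsky2014 Thm 1.1
(category of local rings essentially of finite type over k). Known; to be vendored as a fact and
discharged. -/
@[route_item "route-ResolutionOfSingularities-Valuative"]
def RankOneReduction : Prop :=
  ∀ p : ℕ, p.Prime → (∀ (k K : Type) [Field k] [CharP k p] [Field K] [Algebra k K], (⊤ : IntermediateField k K).FG → ∀ O : ValuationSubring K, (∀ c : k, algebraMap k K c ∈ O) → Nonempty O.valuation.RankOne → ∃ (A : Subalgebra k K) (h : A.toSubring ≤ O.toSubring), A.FG ∧ IsFractionRing A K ∧ IsRegularLocalRing (Localization.AtPrime (Ideal.comap (Subring.inclusion h) (IsLocalRing.maximalIdeal O)))) → ∀ (k K : Type) [Field k] [CharP k p] [Field K] [Algebra k K], (⊤ : IntermediateField k K).FG → ∀ O : ValuationSubring K, (∀ c : k, algebraMap k K c ∈ O) → ∃ (A : Subalgebra k K) (h : A.toSubring ≤ O.toSubring), A.FG ∧ IsFractionRing A K ∧ IsRegularLocalRing (Localization.AtPrime (Ideal.comap (Subring.inclusion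 h) (IsLocalRing.maximalIdeal O)))

-- `RankOneReduction` holds: proved by `Summit.ResolutionOfSingularities.ResolutionOfSingularities.Theorems.rankOneReduction_proof` @ d76d53008079 (its module imports this route file, so no `_holds` link can be stated here).

/-- item stmt-ResolutionOfSingularities-0644 · support · rank 5 · closed · proved by Summit.ResolutionOfSingularities.ResolutionOfSingularities.Theorems.rankOneRel_proof @ a92f9d4d8a62 (prover) · by planner
Rank-one reduction, relative form (supersedes stmt-0563): if RELATIVE LU holds for all rank-one
valuation rings (Nonempty O.valuation.RankOne: value group ↪ ℝ≥0, nontrivial) of f.g. K/k, char k =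
p, then LUrel_p. This IS NovacoskiSpivakovsky2014 (arXiv:1204.4751) Thm 1.1 p.2 with M = local rings
essentially of finite type over k (closed under homomorphic images, f.g. birational extensions,
localizations ✓) and LU := Def 2.20 (sequence of local blowing-ups R → R^(n) ⊆ O_ν with R^(n)
regular; 'R ≤ A ⊆ O, A f.g.' localised at the centre is one local blowing-up along an ideal, Def
2.11, and sequences compose). KNOWN — filed so the fact gets vendored (cite item) and the discharge
(noetherian-local-ring language ↔ Subalgebra/ValuationSubring; composite valuations via
ValuationSubring's linear order / primeSpectrumEquiv; est. 300+ lines) becomes Lean-visible. Lets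
the rank-2/3 work restrict to rank-one O. -/
@[route_item "route-ResolutionOfSingularities-Valuative"]
def RankOneRel : Prop :=
  ∀ p : ℕ, p.Prime → (∀ (k K : Type) [Field k] [CharP k p] [Field K] [Algebra k K], (⊤ : IntermediateField k K).FG → ∀ O : ValuationSubring K, (∀ c : k, algebraMap k K c ∈ O) → Nonempty O.valuation.RankOne → ∀ R : Subalgebra k K, R.FG → R.toSubring ≤ O.toSubring → ∃ (A : Subalgebra k K) (h : A.toSubring ≤ O.toSubring), R ≤ A ∧ A.FG ∧ IsFractionRing A K ∧ IsRegularLocalRing (Localization.AtPrime (Ideal.comap (Subring.inclusion h) (IsLocalRing.maximalIdeal O)))) → ∀ (k K : Type) [Field k] [CharP k p] [Field K] [Algebra k K], (⊤ : IntermediateField k K).FG → ∀ O : ValuationSubring K, (∀ c : k, algebraMap k K c ∈ O) → ∀ R : Subalgebra k K, R.FG → R.toSubring ≤ O.toSubring → ∃ (A : Subalgebra k K) (h : A.toSubring ≤ O.toSubring), R ≤ A ∧ A.FG ∧ IsFractionRing A K ∧ IsRegularLocalRing (Localization.AtPrime (Ideal.comap (Subring.inclusion h) (IsLocalRing.maximalIdeal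 O)))

-- `RankOneRel` holds: proved by `Summit.ResolutionOfSingularities.ResolutionOfSingularities.Theorems.rankOneRel_proof` @ a92f9d4d8a62 (its module imports this route file, so no `_holds` link can be stated here).

/-- item stmt-ResolutionOfSingularities-0738 · support · rank 5 · closed · proved by Summit.ResolutionOfSingularities.ResolutionOfSingularities.Theorems.rankOneRelOfNS2014_proof @ d7a6c7650226 (prover) · by planner
[support] Rank-one reduction, relative form, DISCHARGED from the vendored named fact (supersedes
stmt-0644, which IS NovacoskiSpivakovsky2014 = arXiv:1204.4751 Thm 1.1 p.2 modulo translation;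
grounders g4-4/g4-7: known → re-file with (h : Fact) →). Signature =
Literature.AlgebraicGeometry.Resolution.NovacoskiSpivakovsky2014
(Literature/AlgebraicGeometry/Resolution/RankOneReduction.lean) → <0644 verbatim>. Pure glue, est.
300 lines: (i) a f.g. R ⊆ O without Frac R = K is first enlarged to R[y] with y_i ∈ {x_i, x_i⁻¹} ∩ O
for field generators x_i of K/k, so IsFractionRing R[y] K and
Literature.AlgebraicGeometry.Resolution.RelLocalUniformization applies; (ii) RelLocalUniformization
k K′ O′ is vacuous when K′/k is not f.g. (no f.g. R has Frac R = K′), so the fact hypothesis ∀ K′ O′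
rank-one is met from the item hypothesis (derive (⊤ : IntermediateField k K′).FG from R.FG +
IsFractionRing R K′; k ⊆ O′ from R ≤ O′); (iii) IsFractionRing A K from R[y] ≤ A ≤ K. Purpose: lets
work on 0641/0642 restrict to rank-one O (Temkin arXiv:0804.1554 Thm 4.1.1 p.5: simultaneous
inseparable log-LU in height one). -/
@[route_item "route-ResolutionOfSingularities-Valuative"]
def RankOneRelOfNS2014 : Prop :=
  Literature.AlgebraicGeometry.Resolution.NovacoskiSpivakovsky2014 → ∀ p : ℕ, p.Prime → (∀ (k K : Type) [Field k] [CharP k p] [Field K] [Algebra k K], (⊤ : IntermediateField k K).FG → ∀ O : ValuationSubring K, (∀ c : k, algebraMap k K c ∈ O) → Nonempty O.valuation.RankOne → ∀ R : Subalgebra k K, R.FG → R.toSubring ≤ O.toSubring → ∃ (A : Subalgebra k K) (h : A.toSubring ≤ O.toSubring), R ≤ A ∧ A.FG ∧ IsFractionRing A K ∧ IsRegularLocalRing (Localization.AtPrime (Ideal.comap (Subring.inclusion h) (IsLocalRing.maximalIdeal O)))) → ∀ (k K : Type) [Field k] [CharP k p] [Field K] [Algebra k K], (⊤ : IntermediateField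 k K).FG → ∀ O : ValuationSubring K, (∀ c : k, algebraMap k K c ∈ O) → ∀ R : Subalgebra k K, R.FG → R.toSubring ≤ O.toSubring → ∃ (A : Subalgebra k K) (h : A.toSubring ≤ O.toSubring), R ≤ A ∧ A.FG ∧ IsFractionRing A K ∧ IsRegularLocalRing (Localization.AtPrime (Ideal.comap (Subring.inclusion h) (IsLocalRing.maximalIdeal O)))

-- `RankOneRelOfNS2014` holds: proved by `Summit.ResolutionOfSingularities.ResolutionOfSingularities.Theorems.rankOneRelOfNS2014_proof` @ d7a6c7650226 (its module imports this route file, so no `_holds` link can be stated here).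

/-- item stmt-ResolutionOfSingularities-0739 · support · rank 9 · closed · proved by Summit.ResolutionOfSingularities.ResolutionOfSingularities.Theorems.lurelOfResolution_proof @ 463b36317c39 (prover) · by planner
[support] Faithfulness of the relative pivot: ResolutionInChar p → LUrel_p (converse of PatchingRel
0642; shows the thesis 0639 is EQUIVALENT to the summit in char p, not stronger). Proof on paper
(folklore, Zariski1940 / NovacoskiSpivakovsky2014 §1): given f.g. R ⊆ O, enlarge to R′ = R[y] (y_i ∈
{x_i, x_i⁻¹} ∩ O, x_i field generators) so Frac R′ = K; X := Spec R′ is reduced separated f.t. over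
k; ResolutionInChar gives π : X′ → X proper birational with X′ regular; O dominates R′_(m_O ∩ R′),
so by the valuative criterion of properness (Mathlib AlgebraicGeometry/ValuativeCriterion.lean,
existence part for IsProper) Spec O → X lifts to X′; the image x′ of the closed point has O_{X′,x′}
regular and dominated by O; take an affine open Spec A ∋ x′ — A is f.g. over k (X′ f.t.), R′ → A
injective with A ⊆ O (domination + birationality: A ⊆ Frac A = K and A ⊆ O_{X′,x′} ⊆ O), Frac A = K
(π birational), A_(m_O ∩ A) = O_{X′,x′} regular. Lean glue needed: centre of a valuation on a f.t.
k-scheme via ValuativeCriterion; Scheme.IsRegular stalk ↔ IsRegularLocalRing (Localization.AtPrime)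
on an affine chart; IsBirational ⇒ function field preserved. This is exactly the "centre of O on a
proper model -/
@[route_item "route-ResolutionOfSingularities-Valuative"]
def LurelOfResolution : Prop :=
  ∀ p : ℕ, p.Prime → Literature.AlgebraicGeometry.Resolution.ResolutionInChar.{0} p → ∀ (k K : Type) [Field k] [CharP k p] [Field K] [Algebra k K], (⊤ : IntermediateField k K).FG → ∀ O : ValuationSubring K, (∀ c : k, algebraMap k K c ∈ O) → ∀ R : Subalgebra k K, R.FG → R.toSubring ≤ O.toSubring → ∃ (A : Subalgebra k K) (h : A.toSubring ≤ O.toSubring), R ≤ A ∧ A.FG ∧ IsFractionRing A K ∧ IsRegularLocalRing (Localization.AtPrime (Ideal.comap (Subring.inclusion h) (IsLocalRing.maximalIdeal O)))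

-- `LurelOfResolution` holds: proved by `Summit.ResolutionOfSingularities.ResolutionOfSingularities.Theorems.lurelOfResolution_proof` @ 463b36317c39 (its module imports this route file, so no `_holds` link can be stated here).

/-- item stmt-ResolutionOfSingularities-0559 · assembly · rank 1 · closed · proved by Literature.AlgGeom.resolutionOfSingularities_of_localUniformization_and_patching (refuter) · by planner
LU_p ∧ (LU_p -> ResolutionInChar p) for all primes p implies the summit (modus ponens +
resolutionOfSingularities_iff). -/
@[route_item "route-ResolutionOfSingularities-Valuative"]
def Assembly : Prop :=
  (∀ p : ℕ, p.Prime → (∀ (k K : Type) [Field k] [CharP k p] [Field K] [Algebra k K], (⊤ : IntermediateField k K).FG → ∀ O : ValuationSubring K, (∀ c : k, algebraMap k K c ∈ O) → ∃ (A : Subalgebra k K) (h : A.toSubring ≤ O.toSubring), A.FG ∧ IsFractionRing A K ∧ IsRegularLocalRing (Localization.AtPrime (Ideal.comap (Subring.inclusion h) (IsLocalRing.maximalIdeal O)))) ∧ ((∀ (k K : Type) [Field k] [CharP k p] [Field K] [Algebra k K], (⊤ : IntermediateField k K).FG → ∀ O : ValuationSubring K, (∀ c : k, algebraMap k K c ∈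 O) → ∃ (A : Subalgebra k K) (h : A.toSubring ≤ O.toSubring), A.FG ∧ IsFractionRing A K ∧ IsRegularLocalRing (Localization.AtPrime (Ideal.comap (Subring.inclusion h) (IsLocalRing.maximalIdeal O)))) → Literature.AlgebraicGeometry.Resolution.ResolutionInChar.{0} p)) → _root_.ResolutionOfSingularities

/-- `Assembly` holds: proved by `Literature.AlgGeom.resolutionOfSingularities_of_localUniformization_and_patching`. -/
theorem Assembly_holds : Assembly := _root_.Literature.AlgGeom.resolutionOfSingularities_of_localUniformization_and_patching

-- records of items no longer active in this route (dropped / restated):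
-- earlier Assembly2 (stmt-ResolutionOfSingularities-0640, dropped 2026-08-16T14:15:59Z): proved by Literature.AlgGeom.resolutionOfSingularities_of_relLocalUniformization_and_patching — (∀ p : ℕ, p.Prime → (∀ (k K : Type) [Field k] [CharP k p] [Field K] [Algebra k K], (⊤ : IntermediateField k K).FG → ∀ O : ValuationSubring K, (∀ c : k, algebraMap k K c ∈ O) → ∀ R : Subalgebra k K, R.FG → R.toSubring 

/-! D-0027 §2.1 — DECIDING THEOREM (planner-authored via `route open/edit --closes-file`; by planner-rbadge-ResolutionOfSingularities-Valua-79a0b988-g2-0 2026-08-15T16:36:35Z):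
its hypotheses are this route's items and its conclusion the sub-problem Statement (glue_lint), and it elaborates with this file. -/

/-- Deciding theorem of route `Valuative` (D-0027 §2.1). For every prime `p`: local uniformization of
`α_p`-torsors over bases regular at the centre (crux `LuAlphaPTorsor`, rank 2) gives, by Temkin's
inseparable reduction (support `TorsorToLurel`), RELATIVE Zariski local uniformization `LUrel_p` in
characteristic `p`; Zariski patching (crux `PatchingRel`, rank 3) turns `LUrel_p` into
`ResolutionInChar p`; the summit `ResolutionOfSingularities` is `∀ p, p.Prime → ResolutionInChar p`
by definition. Pure logic. -/
@[closes "route-ResolutionOfSingularities-Valuative"] theorem closes (h₂ : LuAlphaPTorsor) (h₄ : TorsorToLurel) (h₃ : PatchingRel) :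
    _root_.ResolutionOfSingularities :=
  fun p hp => h₃ p hp (h₄ p hp (h₂ p hp))

end Summit.ResolutionOfSingularities.ResolutionOfSingularities.Theses.Valuative
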